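import Summits.ValiantsHypothesis.ValiantsHypothesis.Theses.RefutationDegree
import Summits.ValiantsHypothesis.ValiantsHypothesis.Theorems.HubHub

/-!
# RefutationDegree — `Assembly` (item stmt-ValiantsHypothesis-5648)

The rank-1 assembly item of route `RefutationDegree`:
`SosSound → CertWindowQP → ValiantsHypothesis`.

Pure bookkeeping over PROVED Literature facts (no unproved named fact is a hypothesis).  Suppose
the permanent family `(per_n)_n` over `ℂ` were a `VP` family.  By
`Literature.Computability.AlgebraicComplexity.isQPBounded_determinantalComplexity_of_isVPFamily_holds`
(Bürgisser–Clausen–Shokrollahi 1997, Cor. (21.40)) `n ↦ dc(per_n)` is then quasi-polynomially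
bounded, `dc(per_n) ≤ 2^((log₂ n + c)^c)` for some constant `c` and all `n`.  The certificate
window `CertWindowQP` at this `c` produces an `n` together with Hermitian-SOS refutations of the
representation system Rep(n,m) for every `m ≤ 2^((log₂ n + c)^c)`, in particular for
`m := dc(per_n)`; soundness `SosSound` turns that certificate into
`¬ HasDetRepr per_n (dc per_n)`, contradicting attainment of the determinantal complexity
(`Literature.Computability.AlgebraicComplexity.hasDetRepr_determinantalComplexity_holds`,
Valiant universality / Mignon–Ressayre 2004 §1).  Hence the permanent family is not a `VP`
family, and the hub lemma `Summit.ValiantsHypothesis.Hub.valiantsHypothesis_of_not_isVPFamily_per`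
(Theorems/HubHub.lean), fed with the renaming bridge
`Literature.Computability.AlgebraicComplexity.mem_VP_ofFintype_iff_holds` and Valiant's theorem
`Literature.Computability.AlgebraicComplexity.perFamily_mem_VNP_holds ℂ`, yields
`ValiantsHypothesis` (`VP ℂ ≠ VNP ℂ`).  The theorem is unconditional.
-/

namespace Summit.ValiantsHypothesis.Theorems.RefutationDegree

open Literature.Computability.AlgebraicComplexity

/-- **Assembly** (item stmt-ValiantsHypothesis-5648 of route RefutationDegree):
`SosSound → CertWindowQP → ValiantsHypothesis`.  If `(per_n)_n` were a `VP` family then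
`dc(per_n) ≤ 2^((log₂ n + c)^c)` for some `c` (BCS97 Cor. (21.40),
`isQPBounded_determinantalComplexity_of_isVPFamily_holds`); `CertWindowQP` at this `c` gives an
`n` with a Hermitian-SOS refutation of Rep(n, dc(per_n)), which `SosSound` turns into
`¬ HasDetRepr per_n (dc per_n)` — absurd by attainment
(`hasDetRepr_determinantalComplexity_holds`).  So the permanent is not a `VP` family and the hub
lemma `valiantsHypothesis_of_not_isVPFamily_per` (with `mem_VP_ofFintype_iff_holds` and
`perFamily_mem_VNP_holds ℂ`) concludes `VP ℂ ≠ VNP ℂ`. [folklore] -/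
theorem assembly_proof :
    Summit.ValiantsHypothesis.ValiantsHypothesis.Theses.RefutationDegree.Assembly := by
  unfold Summit.ValiantsHypothesis.ValiantsHypothesis.Theses.RefutationDegree.Assembly
  intro hSound hX
  classical
  refine Summit.ValiantsHypothesis.Hub.valiantsHypothesis_of_not_isVPFamily_per ?_
    (mem_VP_ofFintype_iff_holds _) (perFamily_mem_VNP_holds ℂ)
  intro hfam
  -- VP families have quasi-polynomially bounded determinantal complexity (BCS97 Cor. (21.40))
  obtain ⟨c, hc⟩ := isQPBounded_determinantalComplexity_of_isVPFamily_holds _ hfam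
  -- the certificate window at this constant `c`, read at `m := dc(per_n)`
  obtain ⟨c', hX'⟩ := hX
  obtain ⟨n, hn⟩ := hX' c
  have hcert := hn (determinantalComplexity (perPoly (Fin n) ℂ)) (hc n)
  -- soundness excludes a size-`dc(per_n)` representation, contradicting attainment
  exact hSound n (determinantalComplexity (perPoly (Fin n) ℂ))
    ((determinantalComplexity (perPoly (Fin n) ℂ) + 2) ^ c') hcert
    (hasDetRepr_determinantalComplexity_holds _)

end Summit.ValiantsHypothesis.Theorems.RefutationDegree
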